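import Literature.AnabelianGeometry.SemiGraphs.PSCVertCountConnectivityShapes
import Literature.AnabelianGeometry.SemiGraphs.PSCCompactificationTransfer
import Literature.AnabelianGeometry.SemiGraphs.ProSigmaCompletionMaxQuotient
import Literature.GroupTheory.ProfiniteSubquotients
import HarnessLib

/-!
# The two-component origin with its predicate EXPOSED: F-0459, F-3811 and `MapAlongProLOfPSCTypeHolds` at genuine two-vertex data

Mochizuki, *A combinatorial version of the Grothendieck conjecture* [CombGC] §1: Def. 1.1 (i)(ii) p. 6,
Rmk. 1.1.3 p. 8, Prop. 1.2 (i) p. 8, and Thm. 1.6 (i) p. 13 "we may assume that `Σ = {l}`" (the image of a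
PSC datum along the maximal pro-`S` quotient, typed `PSCDatum.mapAlong` / `MapAlongProLOfPSCTypeHolds`,
abc-iut-L3-t4 `PSCCoveringMapAlong.lean`). [cite: MochizukiCombGC2007, Def 1.1 p.6]
[cite: MochizukiCombGC2007, Thm 1.6(i) p.13]

PROOF-ONLY file (abc-iut cell, [CombGC] non-vacuity programme; seat abc-iut-w4-d052 gen 4).  The origin
`Ω_tc` of data of TWO-COMPONENT SHAPE (abc-iut-f-165's `exists_twoComponentOrigin_holds`,
`PSCTwoComponentShape.lean`: on a profinite group, no cusps, two vertices `v₀ ≠ v₁` of genera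
`g₁, g₂ ≥ 1`, one node `e₀` joining them, and along a pro-`Σ` completion `ι : Γ_{g₁+g₂,0} → Π` of the
surface group of the smoothing `Π_{v₀}`, `Π_{v₁}` = the closures of the two handle groups, `Π_{e₀}` = the
closure of the vanishing cycle `∏_{i<g₁}[a_i,b_i]`) was so far only available INSIDE existential
statements.  `exists_twoComponentOrigin_rows` exports it with its membership predicate as an `↔`, so that
later files can add rows at the SAME origin, together with:

* `hprof` (every datum profinite) and inhabitation for every nonempty set of primes `Σ` and all
  `g₁, g₂ ≥ 1` (abc-iut-f-165's inhabitant, sturdy for `g₁, g₂ ≥ 2`);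
* F-0459 `OpenInterDeterminesComponentHolds Ω_tc` ([CombGC] Prop. 1.2 (i); abc-iut-f-165's unramified
  characters + abc-iut-f-165's criterion `openInterDeterminesComponentHolds_of_unrCharacters`);
* F-3811 `VertCountLeNodeCountSuccHolds Ω_tc` (Rmk. 1.1.3 connectedness, `vertCountLeNodeCountSucc_of_twoComponent`);
* **`MapAlongProLOfPSCTypeHolds Ω_tc`** — the origin is CLOSED under passage to the maximal pro-`S`
  quotient (`∅ ≠ S ⊆ Σ`): the image datum is of two-component shape along `f ∘ ι`, a pro-`S` completion
  (abc-iut-L3's `comp_isMaxProSigmaQuotient`), the image of a closure being the closure of the image for the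
  closed map `f` (`map_topologicalClosure_eq_of_isClosedMap`); first instance of this row at genuine
  MULTI-VERTEX data.

NOT exported (and FALSE here): `RestrictBDOfPSCTypeHolds Ω_tc` — finite étale coverings of a two-component
curve have unboundedly many components (abc-iut-w5-d174, `PSCOriginVertexGrowth.lean`); an origin carrying
all inputs of the Thm. 1.6 kernels must be covering-closed.  Consistency evidence at genuine data; not the
printed statements for all pointed stable curves; nothing here takes a side on [IUTchIII] Cor. 3.12.
-/

noncomputable section

namespace Literature.AnabelianGeometry.SemiGraphs

open Multiplicative
open scoped Pointwise
open Literature.GroupTheory.CombinatorialGroupTheory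
open SemiGraphOfAnabelioids (IsProSigmaCompletion)

/-! ### Plumbing: Hausdorff images of profinite groups -/

-- adapted from abc-iut-w5-d183's `PSCThm16InputsSmoothProperGenuine.lean` (private there)
/-- A continuous surjection from a compact space has compact target. [folklore] -/
private theorem compactSpace_of_surjective {P : Type} [TopologicalSpace P] [CompactSpace P] {Q : Type}
    [TopologicalSpace Q] {f : P → Q} (hf : Continuous f) (hs : Function.Surjective f) :
    CompactSpace Q :=
  ⟨by rw [← hs.range_eq]; exact isCompact_range hf⟩

/-- A Hausdorff group that is a continuous homomorphic image of a profinite group is totally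
disconnected (`Π ⧸ ker f → Q` is a continuous bijection from a compact space, `Π ⧸ ker f` is totally
disconnected). [folklore] -/
private theorem totallyDisconnectedSpace_of_surjective {P : Type} [Group P] [TopologicalSpace P]
    [IsTopologicalGroup P] [CompactSpace P] [TotallyDisconnectedSpace P] {Q : Type} [Group Q]
    [TopologicalSpace Q] [T2Space Q] (f : P →* Q) (hf : Continuous f) (hs : Function.Surjective f) :
    TotallyDisconnectedSpace Q := by
  have hK : IsClosed (f.ker : Set P) := by
    have : (f.ker : Set P) = f ⁻¹' {1} := by
      ext x
      simp only [SetLike.mem_coe, MonoidHom.mem_ker, Set.mem_preimage, Set.mem_singleton_iff]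
    rw [this]
    exact isClosed_singleton.preimage hf
  haveI := Literature.GroupTheory.ProfiniteSubquotients.totallyDisconnectedSpace_quotient f.ker hK
  let φ : P ⧸ f.ker ≃* Q := QuotientGroup.quotientKerEquivOfSurjective f hs
  have hφ : Continuous φ := by
    refine (QuotientGroup.isQuotientMap_mk f.ker).continuous_iff.mpr ?_
    have : (φ : P ⧸ f.ker → Q) ∘ QuotientGroup.mk = f := by
      funext x
      rfl
    rw [this]
    exact hf
  exact (Continuous.homeoOfEquivCompactToT2 (f := φ.toEquiv) hφ).totallyDisconnectedSpace

/-! ### The two-component origin with exposed predicate -/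

open PSCDatum in
/-- **The two-component origin `Ω_tc`, predicate exposed, with its rows.**  There is an origin `Ω` whose
membership predicate is EXACTLY "datum of two-component shape on a profinite group" (first conjunct, an
`↔`; the displayed form of abc-iut-f-165's `exists_twoComponentOrigin_holds`), such that: every `Ω`-datum
is profinite (`hprof`); `Ω` is inhabited for every nonempty set of primes `Σ` and all `g₁, g₂ ≥ 1` by a
datum with `Σ_G = Σ`, `i = 2`, `n = 1`, `r = 0`, genera `(g₁, g₂)`, sturdy when `g₁, g₂ ≥ 2`;
[CombGC] Prop. 1.2 (i) `OpenInterDeterminesComponentHolds Ω` (F-0459); Rmk. 1.1.3 connectedness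
`VertCountLeNodeCountSuccHolds Ω` (F-3811); and Thm. 1.6 (i)'s "we may assume `Σ = {l}`" closure
`MapAlongProLOfPSCTypeHolds Ω` — the image of an `Ω`-datum along any presentation of the maximal pro-`S`
quotient (`∅ ≠ S ⊆ Σ`) is again an `Ω`-datum. [cite: MochizukiCombGC2007, Thm 1.6(i) p.13] -/
theorem exists_twoComponentOrigin_rows :
    ∃ Ω : PSCOrigin.{0},
      (∀ ⦃Q : Type⦄ [Group Q] [TopologicalSpace Q] (K : PSCDatum Q),
        Ω.IsOfPSCType K ↔
          ∃ (_ : IsTopologicalGroup Q), CompactSpace Q ∧ TotallyDisconnectedSpace Q ∧ IsEmpty K.graph.C ∧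
            ∃ (g₁ g₂ : ℕ) (ι : PuncturedSurfaceGroup (g₁ + g₂) 0 →* Q) (v₀ v₁ : K.graph.V)
              (e₀ : K.graph.N), 0 < g₁ ∧ 0 < g₂ ∧ IsProSigmaCompletion K.Sigma ι ∧ v₀ ≠ v₁ ∧
              (∀ w, w = v₀ ∨ w = v₁) ∧ (∀ e, e = e₀) ∧ K.graph.nodeEnds e₀ = s(v₀, v₁) ∧
              K.genus v₀ = g₁ ∧ K.genus v₁ = g₂ ∧
              K.vertGp v₀ = ((Subgroup.closure
                (Set.range (fun i : Fin g₁ => PuncturedSurfaceGroup.a (r := 0) (Fin.castAdd g₂ i)) ∪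
                  Set.range (fun i : Fin g₁ => PuncturedSurfaceGroup.b (r := 0) (Fin.castAdd g₂ i)))).map
                    ι).topologicalClosure ∧
              K.vertGp v₁ = ((Subgroup.closure
                (Set.range (fun j : Fin g₂ => PuncturedSurfaceGroup.a (r := 0) (Fin.natAdd g₁ j)) ∪
                  Set.range (fun j : Fin g₂ => PuncturedSurfaceGroup.b (r := 0) (Fin.natAdd g₁ j)))).map
                    ι).topologicalClosure ∧
              K.nodeGp e₀ = ((Subgroup.zpowers (List.ofFn fun i : Fin g₁ =>
                PuncturedSurfaceGroup.a (g := g₁ + g₂) (r := 0) (Fin.castAdd g₂ i) *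
                  PuncturedSurfaceGroup.b (Fin.castAdd g₂ i) *
                    (PuncturedSurfaceGroup.a (Fin.castAdd g₂ i))⁻¹ *
                      (PuncturedSurfaceGroup.b (Fin.castAdd g₂ i))⁻¹).prod).map ι).topologicalClosure) ∧
      (∀ ⦃Q : Type⦄ [Group Q] [TopologicalSpace Q] [IsTopologicalGroup Q] (K : PSCDatum Q),
        Ω.IsOfPSCType K → CompactSpace Q ∧ TotallyDisconnectedSpace Q) ∧
      (∀ (S : Set ℕ), S.Nonempty → (∀ p ∈ S, p.Prime) → ∀ g₁ g₂ : ℕ, 0 < g₁ → 0 < g₂ →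
        ∃ (Q : ProfiniteGrp.{0}) (G : PSCDatum Q), Ω.IsOfPSCType G ∧ G.Sigma = S ∧
          G.graph.i = 2 ∧ G.graph.n = 1 ∧ G.graph.r = 0 ∧
          (∃ v₀ v₁ : G.graph.V, v₀ ≠ v₁ ∧ G.genus v₀ = g₁ ∧ G.genus v₁ = g₂) ∧
          (2 ≤ g₁ → 2 ≤ g₂ → G.IsSturdy)) ∧
      OpenInterDeterminesComponentHolds Ω ∧ VertCountLeNodeCountSuccHolds Ω ∧
      MapAlongProLOfPSCTypeHolds Ω := by
  classical
  -- the origin: data of two-component shape on profinite groups (predicate displayed above)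
  let Ω : PSCOrigin.{0} :=
    ⟨fun {Q} _ _ K => ∃ (_ : IsTopologicalGroup Q), CompactSpace Q ∧ TotallyDisconnectedSpace Q ∧
      IsEmpty K.graph.C ∧
      ∃ (g₁ g₂ : ℕ) (ι : PuncturedSurfaceGroup (g₁ + g₂) 0 →* Q) (v₀ v₁ : K.graph.V)
        (e₀ : K.graph.N), 0 < g₁ ∧ 0 < g₂ ∧ IsProSigmaCompletion K.Sigma ι ∧ v₀ ≠ v₁ ∧
        (∀ w, w = v₀ ∨ w = v₁) ∧ (∀ e, e = e₀) ∧ K.graph.nodeEnds e₀ = s(v₀, v₁) ∧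
        K.genus v₀ = g₁ ∧ K.genus v₁ = g₂ ∧
        K.vertGp v₀ = ((Subgroup.closure
          (Set.range (fun i : Fin g₁ => PuncturedSurfaceGroup.a (r := 0) (Fin.castAdd g₂ i)) ∪
            Set.range (fun i : Fin g₁ => PuncturedSurfaceGroup.b (r := 0) (Fin.castAdd g₂ i)))).map
              ι).topologicalClosure ∧
        K.vertGp v₁ = ((Subgroup.closure
          (Set.range (fun j : Fin g₂ => PuncturedSurfaceGroup.a (r := 0) (Fin.natAdd g₁ j)) ∪
            Set.range (fun j : Fin g₂ => PuncturedSurfaceGroup.b (r := 0) (Fin.natAdd g₁ j)))).map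
              ι).topologicalClosure ∧
        K.nodeGp e₀ = ((Subgroup.zpowers (List.ofFn fun i : Fin g₁ =>
          PuncturedSurfaceGroup.a (g := g₁ + g₂) (r := 0) (Fin.castAdd g₂ i) *
            PuncturedSurfaceGroup.b (Fin.castAdd g₂ i) * (PuncturedSurfaceGroup.a (Fin.castAdd g₂ i))⁻¹ *
              (PuncturedSurfaceGroup.b (Fin.castAdd g₂ i))⁻¹).prod).map ι).topologicalClosure⟩
  have hprof : ∀ ⦃Q : Type⦄ [Group Q] [TopologicalSpace Q] [IsTopologicalGroup Q] (K : PSCDatum Q),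
      Ω.IsOfPSCType K → CompactSpace Q ∧ TotallyDisconnectedSpace Q := by
    intro Q _ _ _ K hK
    obtain ⟨_, hc, ht, -⟩ := hK
    exact ⟨hc, ht⟩
  refine ⟨Ω, fun _ _ _ K => Iff.rfl, hprof, ?_, ?_, ?_, ?_⟩
  · -- inhabitation: abc-iut-f-165's datum over a pro-`Σ` completion of `Γ_{g₁+g₂,0}`
    intro S hS hP g₁ g₂ h₁ h₂
    obtain ⟨_, hinh, -⟩ := exists_twoComponentOrigin_holds
    obtain ⟨Q, ι, G, hι, -, hSig, hi, hn, hr, ⟨v₀, v₁, hne, hg₀, hg₁, hV₀, hV₁, hN⟩, hst⟩ :=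
      hinh S hS hP g₁ g₂ h₁ h₂
    haveI : IsEmpty G.graph.C := by
      rw [← Fintype.card_eq_zero_iff]; exact hr
    -- two vertices and one node, from the counts
    have hV : ∀ w, w = v₀ ∨ w = v₁ := by
      intro w
      by_contra hw
      have hw0 : w ≠ v₀ := fun h => hw (Or.inl h)
      have hw1 : w ≠ v₁ := fun h => hw (Or.inr h)
      have h3 : 3 ≤ Fintype.card G.graph.V := by
        have := Finset.card_le_univ ({v₀, v₁, w} : Finset G.graph.V)
        rw [Finset.card_insert_of_notMem (by simp [hne, hw0.symm]),
          Finset.card_insert_of_notMem (by simp [hw1.symm]), Finset.card_singleton] at this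
        simpa using this
      change Fintype.card G.graph.V = 2 at hi
      omega
    have hn' : Nonempty G.graph.N := by
      rw [← Fintype.card_pos_iff]; change 0 < G.graph.n; omega
    obtain ⟨e₀⟩ := hn'
    have hE : ∀ e, e = e₀ := by
      intro e
      by_contra he
      have h2 : 2 ≤ Fintype.card G.graph.N := by
        have := Finset.card_le_univ ({e, e₀} : Finset G.graph.N)
        rw [Finset.card_insert_of_notMem (by simp [he]), Finset.card_singleton] at this
        exact this
      change Fintype.card G.graph.N = 1 at hn
      omega
    refine ⟨Q, G, ?_, hSig, hi, hn, hr, ⟨v₀, v₁, hne, hg₀, hg₁⟩, hst⟩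
    exact ⟨inferInstance, inferInstance, inferInstance, inferInstance, g₁, g₂, ι, v₀, v₁, e₀, h₁, h₂,
      hSig ▸ hι, hne, hV, hE, (hN e₀).1, hg₀, hg₁, hV₀, hV₁, (hN e₀).2⟩
  · -- F-0459: abc-iut-f-165's unramified characters
    refine openInterDeterminesComponentHolds_of_unrCharacters Ω fun Q _ _ _ G hG => ?_
    obtain ⟨_, hcpt, htd, hC, g₁, g₂, ι, v₀, v₁, e₀, h₁, h₂, hι, hv, hV, hE, -, -, -, hV₀, hV₁, hN⟩ := hG
    haveI := hcpt
    haveI := htd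
    haveI := hC
    have hsub : Subsingleton (G.graph.N ⊕ G.graph.C) := ⟨fun x y => by
      rcases x with e | c
      · rcases y with e' | c
        · rw [hE e, hE e']
        · exact isEmptyElim c
      · exact isEmptyElim c⟩
    obtain ⟨ℓ, hℓS⟩ := G.sigma_nonempty
    have hℓ : ℓ.Prime := G.sigma_prime ℓ hℓS
    refine ⟨hcpt, htd, hsub, ℓ, hℓ.one_lt, ?_⟩
    exact G.exists_unrCharacters_of_twoComponent hℓ hℓS h₁ h₂ ι hι v₀ v₁ hV hV₀ hV₁ fun e => by
      rw [hE e]; exact hN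
  · -- F-3811: the two-component shape instance of the connectivity criterion
    intro Q _ _ _ G hG
    obtain ⟨_, hcpt, -, -, g₁, g₂, ι, v₀, v₁, e₀, -, -, hι, -, hV, hE, -, -, -, hV₀, hV₁, hN⟩ := hG
    haveI := hcpt
    exact G.vertCountLeNodeCountSucc_of_twoComponent ι hι v₀ v₁ hV e₀ hV₀ hV₁ fun e => by
      rw [hE e]; exact hN
  · -- closure under the maximal pro-`S` quotient
    intro P _ _ _ _ Q _ _ _ _ G S hS hne f h hG
    obtain ⟨_, hcpt, htd, hC, g₁, g₂, ι, v₀, v₁, e₀, h₁, h₂, hι, hv, hV, hE, hends, hg₀, hg₁, hV₀, hV₁,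
      hN⟩ := hG
    haveI := htd
    haveI : CompactSpace Q := compactSpace_of_surjective h.continuous h.surjective
    have htdQ : TotallyDisconnectedSpace Q :=
      totallyDisconnectedSpace_of_surjective f h.continuous h.surjective
    have hι' : IsProSigmaCompletion S (f.comp ι) :=
      IsProSigmaCompletion.comp_isMaxProSigmaQuotient hS hι h
    have hcl : IsClosedMap f := h.continuous.isClosedMap
    have hmap : ∀ X : Subgroup (PuncturedSurfaceGroup (g₁ + g₂) 0),
        ((X.map ι).topologicalClosure).map f = (X.map (f.comp ι)).topologicalClosure := fun X => by
      rw [PSCDatum.map_topologicalClosure_eq_of_isClosedMap f h.continuous hcl, Subgroup.map_map]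
    refine ⟨inferInstance, inferInstance, htdQ, hC, g₁, g₂, f.comp ι, v₀, v₁, e₀, h₁, h₂, hι', hv, hV,
      hE, hends, hg₀, hg₁, ?_, ?_, ?_⟩
    · rw [PSCDatum.mapAlong_vertGp, hV₀, hmap]
    · rw [PSCDatum.mapAlong_vertGp, hV₁, hmap]
    · rw [PSCDatum.mapAlong_nodeGp, hN, hmap]

end Literature.AnabelianGeometry.SemiGraphs

end
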